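import Literature.Probability.Percolation.IsoradialUniverseTransfer
import Literature.Probability.Percolation.IsoradialArmUniversality
import HarnessLib

/-!
# Transport of the alternating arm events along a graph isomorphism and a bijection of faces

Companion of `Literature.Probability.Percolation.IsoradialUniverseTransfer` (which transports the
canonical measure `P_G` of an isoradial embedding and its *crossing* events along
`RhombicEmbedding.transfer φ eF`, `φ : G₀ ≃g G`, `eF : F ≃ F₀`). Here the same is done for the
cluster-separated alternating arm events `RhombicEmbedding.embAltArmEvent j r R`
(`IsoradialArmUniversality`; Grimmett–Manolescu, PTRF 159 (2014) = arXiv:1204.0505, §3 `A_{2j}`,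
§8.2 `Ã_{2j}`): the transported embedding draws the same picture, so a configuration `ω` of `G`
has `2j` alternating arms iff its relabelling `φ⁻¹ '' ω` has them for `G₀`
(`preimage_relabel_embAltArmEvent`), and the probabilities agree
(`real_transfer_embAltArmEvent`, through `isoradialPercolation_transfer`). Ingredients:
restricted open connections under relabelling in both directions (`LatticeSymmetry`,
`relabel_mem_openConnIn`, and its inverse), and the dual side `dualOpenGraph_transfer_relabel_adj` /
`transfer_dualConnIn_relabel_iff` (the dual open graph of the transported embedding in the
relabelled configuration is the dual open graph of `ω`, faces renamed by `eF`).

Purpose: the per-graph arm-exponent statements of `Isoradial` / `IsoradialArmUniversality` are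
universe-polymorphic in `V, F`, whereas Proposition 8.1 is vendored over `Type`
(`GrimmettManolescu2014_altArmComparability`, `GrimmettManolescu2014_armComparability_one_two`);
with this file the `Type`-level consequences pass to every universe (used in
`IsoradialExponentUniversalityUncentred`). Transport of structure only; everything is proved.

## References

* G. R. Grimmett, I. Manolescu, *Bond percolation on isoradial graphs: criticality and
  universality*, PTRF 159 (2014) 273–327, arXiv:1204.0505, §3 (arm events), §8.2.
* G. Grimmett, *Percolation*, 2nd ed. (1999), §1.6 (relabelling of configurations).
-/

noncomputable section

open MeasureTheory

namespace Literature.Probability.Percolation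

open LatticeModels LatticeModels.RhombicEmbedding Percolation

/-! ### Restricted open connections under relabelling, both directions -/

section Relabel

variable {V W : Type*}

/-- The annulus of a relabelled drawing is the relabelled annulus. [folklore] -/
theorem annulusPts_comp {α β : Type*} (z : α → ℂ) (e : β → α) (r R : ℕ) :
    annulusPts (z ∘ e) r R = e ⁻¹' annulusPts z r R := rfl

/-- `{x ↔ y in S}` holds for `ω` iff `{ψ x ↔ ψ y in ψ(S)}` holds for `ψ '' ω`
(`relabel_mem_openConnIn` and its inverse along `ψ⁻¹`; a local copy of
`relabel_mem_openConnIn_iff` of `SlabCriticality`, not imported here to keep the import closure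
of the isoradial files small). [folklore] -/
private theorem relabel_openConnIn_iff_aux (ψ : V ≃ W) {ω : BondConfig V} {S : Set V} {x y : V} :
    BondConfig.relabel (sym2Equiv ψ) ω ∈ openConnIn (ψ '' S) (ψ x) (ψ y) ↔
      ω ∈ openConnIn S x y := by
  refine ⟨fun h => ?_, relabel_mem_openConnIn ψ⟩
  have h' := relabel_mem_openConnIn ψ.symm h
  simpa only [relabel_symm_relabel, Equiv.symm_image_image, Equiv.symm_apply_apply] using h'

end Relabel

/-! ### The dual open graph and dual connections under transport -/

section Dual

variable {V V₀ F F₀ : Type*} {G : SimpleGraph V} {G₀ : SimpleGraph V₀}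
  (emb : RhombicEmbedding G F) (φ : G₀ ≃g G) (eF : F ≃ F₀)

/-- An edge of `G₀` is closed in the relabelled configuration `φ⁻¹ '' ω` iff its image edge is
closed in `ω`. [folklore] -/
theorem dart_edge_notMem_relabel_iff (ω : BondConfig V) (d₀ : G₀.Dart) :
    d₀.edge ∉ BondConfig.relabel (sym2Equiv φ.toEquiv.symm) ω ↔ (dartMap φ d₀).edge ∉ ω := by
  rw [BondConfig.mem_relabel_iff, sym2Equiv_symm, Equiv.symm_symm, sym2Equiv_apply,
    dartMap_edge]
  rfl

/-- **The dual open graph is transported**: in the relabelled configuration `φ⁻¹ '' ω`, two faces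
of the transported embedding are dual-adjacent iff the corresponding faces of `emb` are
dual-adjacent in `ω` (dual adjacency is read off the darts, `dartMap φ` is a bijection of darts,
and closed edges correspond). [folklore] -/
theorem dualOpenGraph_transfer_relabel_adj (ω : BondConfig V) (f₀ g₀ : F₀) :
    ((emb.transfer φ eF).dualOpenGraph (BondConfig.relabel (sym2Equiv φ.toEquiv.symm) ω)).Adj
        f₀ g₀ ↔ (emb.dualOpenGraph ω).Adj (eF.symm f₀) (eF.symm g₀) := by
  simp only [RhombicEmbedding.dualOpenGraph, SimpleGraph.fromRel_adj, transfer_leftFace,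
    transfer_rightFace, ne_eq, eF.symm.injective.eq_iff]
  have key := dart_edge_notMem_relabel_iff φ ω
  constructor
  · rintro ⟨hne, h | h⟩
    · obtain ⟨d₀, h1, h2, h3⟩ := h
      refine ⟨hne, Or.inl ⟨dartMap φ d₀, ?_, ?_, (key d₀).1 h3⟩⟩
      · rw [← h1, Equiv.symm_apply_apply]
      · rw [← h2, Equiv.symm_apply_apply]
    · obtain ⟨d₀, h1, h2, h3⟩ := h
      refine ⟨hne, Or.inr ⟨dartMap φ d₀, ?_, ?_, (key d₀).1 h3⟩⟩
      · rw [← h1, Equiv.symm_apply_apply]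
      · rw [← h2, Equiv.symm_apply_apply]
  · rintro ⟨hne, h | h⟩
    · obtain ⟨d, h1, h2, h3⟩ := h
      obtain ⟨d₀, rfl⟩ := dartMap_surjective φ d
      refine ⟨hne, Or.inl ⟨d₀, ?_, ?_, (key d₀).2 h3⟩⟩
      · rw [h1, Equiv.apply_symm_apply]
      · rw [h2, Equiv.apply_symm_apply]
    · obtain ⟨d, h1, h2, h3⟩ := h
      obtain ⟨d₀, rfl⟩ := dartMap_surjective φ d
      refine ⟨hne, Or.inr ⟨d₀, ?_, ?_, (key d₀).2 h3⟩⟩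
      · rw [h1, Equiv.apply_symm_apply]
      · rw [h2, Equiv.apply_symm_apply]

/-- **Dual connections are transported**: `{eF f ↔* eF g in eF(S)}` for the transported
embedding and the relabelled configuration iff `{f ↔* g in S}` for `emb` and `ω` (walks of the
one dual open graph are renamed walks of the other, `dualOpenGraph_transfer_relabel_adj`).
[folklore] -/
theorem transfer_dualConnIn_relabel_iff (ω : BondConfig V) (S : Set F) (f g : F) :
    (emb.transfer φ eF).dualConnIn (BondConfig.relabel (sym2Equiv φ.toEquiv.symm) ω) (eF '' S)
        (eF f) (eF g) ↔ emb.dualConnIn ω S f g := by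
  -- the renaming of faces as an isomorphism of the two dual open graphs
  let θ : (emb.transfer φ eF).dualOpenGraph (BondConfig.relabel (sym2Equiv φ.toEquiv.symm) ω) ≃g
      emb.dualOpenGraph ω :=
    ⟨eF.symm, fun {a b} => (dualOpenGraph_transfer_relabel_adj emb φ eF ω a b).symm⟩
  rw [RhombicEmbedding.dualConnIn_iff_exists_walk, RhombicEmbedding.dualConnIn_iff_exists_walk]
  constructor
  · rintro ⟨w, hw⟩
    refine ⟨(w.map θ.toHom).copy (eF.symm_apply_apply f) (eF.symm_apply_apply g), fun v hv => ?_⟩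
    rw [SimpleGraph.Walk.support_copy, SimpleGraph.Walk.support_map, List.mem_map] at hv
    obtain ⟨a, ha, rfl⟩ := hv
    obtain ⟨b, hb, hab⟩ := hw a ha
    change eF.symm a ∈ S
    rw [← hab, Equiv.symm_apply_apply]
    exact hb
  · rintro ⟨w, hw⟩
    refine ⟨(w.map θ.symm.toHom).copy rfl rfl, fun v hv => ?_⟩
    rw [SimpleGraph.Walk.support_copy, SimpleGraph.Walk.support_map, List.mem_map] at hv
    obtain ⟨a, ha, rfl⟩ := hv
    exact Set.mem_image_of_mem _ (hw a ha)

end Dual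

/-! ### The alternating arm events and their probabilities are invariant -/

section Arms

variable {V V₀ F F₀ : Type*} {G : SimpleGraph V} {G₀ : SimpleGraph V₀}
  (emb : RhombicEmbedding G F) (φ : G₀ ≃g G) (eF : F ≃ F₀)

/-- **The alternating arm event of the transported embedding pulls back to that of the original
one**: `(φ⁻¹ '' ·)⁻¹ (A_{2j}(r, R)[emb.transfer φ eF]) = A_{2j}(r, R)[emb]` — the transported
embedding draws vertex `v₀` at `z (φ v₀)` and face `f₀` at `c (eF⁻¹ f₀)`, so annuli, open
crossings inside them, their cluster separation and the dual side all correspond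
(`relabel_mem_openConnIn` both ways, `transfer_dualConnIn_relabel_iff`).
(Grimmett–Manolescu 2014, §3, `A_{2j}`; transport of structure.) [folklore] -/
theorem preimage_relabel_embAltArmEvent (j r R : ℕ) :
    BondConfig.relabel (sym2Equiv φ.toEquiv.symm) ⁻¹' (emb.transfer φ eF).embAltArmEvent j r R =
      emb.embAltArmEvent j r R := by
  set ψ : V ≃ V₀ := φ.toEquiv.symm with hψ
  have hA : annulusPts (emb.transfer φ eF).z r R = ψ '' annulusPts emb.z r R := by
    rw [Equiv.image_eq_preimage_symm, hψ, Equiv.symm_symm]; rfl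
  have hC : annulusPts (emb.transfer φ eF).c r R = eF '' annulusPts emb.c r R := by
    rw [Equiv.image_eq_preimage_symm]; rfl
  have hψφ : ∀ v₀ : V₀, ψ (φ v₀) = v₀ := fun v₀ => φ.toEquiv.symm_apply_apply v₀
  have hφψ : ∀ v : V, φ (ψ v) = v := fun v => φ.toEquiv.apply_symm_apply v
  ext ω
  simp only [Set.mem_preimage, RhombicEmbedding.embAltArmEvent, Set.mem_setOf_eq, transfer_z,
    transfer_c]
  rw [hA, hC]
  constructor
  · rintro ⟨⟨x₀, y₀, hxy, hsep⟩, ⟨f₀, g₀, hfg, hsep'⟩⟩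
    refine ⟨⟨fun i => φ (x₀ i), fun i => φ (y₀ i), fun i => ⟨(hxy i).1, (hxy i).2.1, ?_⟩,
        fun i i' hii' hc => hsep hii' ?_⟩,
      ⟨fun i => eF.symm (f₀ i), fun i => eF.symm (g₀ i), fun i => ⟨?_, ?_, ?_⟩,
        fun i i' hii' hc => hsep' hii' ?_⟩⟩
    · have h := (hxy i).2.2
      rw [← hψφ (x₀ i), ← hψφ (y₀ i)] at h
      exact (relabel_openConnIn_iff_aux ψ).1 h
    · rw [← hψφ (x₀ i), ← hψφ (x₀ i')]
      exact (relabel_openConnIn_iff_aux ψ).2 hc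
    · simpa only [Equiv.apply_symm_apply] using (hfg i).1
    · simpa only [Equiv.apply_symm_apply] using (hfg i).2.1
    · have h := (hfg i).2.2
      rw [← eF.apply_symm_apply (f₀ i), ← eF.apply_symm_apply (g₀ i)] at h
      exact (transfer_dualConnIn_relabel_iff emb φ eF ω _ _ _).1 h
    · rw [← eF.apply_symm_apply (f₀ i), ← eF.apply_symm_apply (f₀ i')]
      exact (transfer_dualConnIn_relabel_iff emb φ eF ω _ _ _).2 hc
  · rintro ⟨⟨x, y, hxy, hsep⟩, ⟨f, g, hfg, hsep'⟩⟩
    refine ⟨⟨fun i => ψ (x i), fun i => ψ (y i), fun i => ⟨?_, ?_, ?_⟩,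
        fun i i' hii' hc => hsep hii' ((relabel_openConnIn_iff_aux ψ).1 hc)⟩,
      ⟨fun i => eF (f i), fun i => eF (g i), fun i => ⟨?_, ?_, ?_⟩,
        fun i i' hii' hc => hsep' hii' ((transfer_dualConnIn_relabel_iff emb φ eF ω _ _ _).1 hc)⟩⟩
    · simpa only [hφψ] using (hxy i).1
    · simpa only [hφψ] using (hxy i).2.1
    · exact (relabel_openConnIn_iff_aux ψ).2 (hxy i).2.2
    · simpa only [Equiv.symm_apply_apply] using (hfg i).1
    · simpa only [Equiv.symm_apply_apply] using (hfg i).2.1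
    · exact (transfer_dualConnIn_relabel_iff emb φ eF ω _ _ _).2 (hfg i).2.2

variable {emb φ eF}

/-- **Alternating arm probabilities are invariant under transport**: `P[A_{2j}(r, R)]` is the
same for `emb.transfer φ eF` and for `emb` (`isoradialPercolation_transfer` and
`preimage_relabel_embAltArmEvent`). (Grimmett–Manolescu 2014, §3; Grimmett 1999, §1.6.)
[folklore] -/
theorem real_transfer_embAltArmEvent (h : emb.IsIsoradial) (j r R : ℕ) :
    (emb.transfer φ eF).isoradialPercolation.real ((emb.transfer φ eF).embAltArmEvent j r R) =
      emb.isoradialPercolation.real (emb.embAltArmEvent j r R) := by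
  rw [isoradialPercolation_transfer h, measureReal_def, measureReal_def,
    MeasurableEquiv.map_apply, preimage_relabel_embAltArmEvent]

end Arms

/-! ### A copy of every countable rhombic tiling on types in `Type` -/

section Shrink

variable {V F : Type*} [Countable V] {G : SimpleGraph V} (emb : RhombicEmbedding G F)

/-- **Every countable isoradial rhombic tiling has an isomorphic copy on types in `Type` with the
same alternating arm probabilities and the same class data.** For `G` countable and locally
finite on `V : Type*`, rhombically embedded with `F : Type*` and `c` injective
(`IsRhombicTiling`), there are `V₀ F₀ : Type`, a locally finite `G₀` on `V₀` and an embedding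
`emb₀` of `G₀` with: the same preconnectedness, isoradiality, tiling condition, BAP(ε) and SGP(I)
for every `ε`, `I`, the same vertex positions up to the renaming (in particular the same set of
drawn vertices, so "a vertex at the origin" is preserved), and
`P_{G₀}[A_{2j}(r, R)] = P_G[A_{2j}(r, R)]` for all `j, r, R`. (Squeeze `V` into `ℕ` and `F` into
`ℂ` as in `hasBoxCrossingProperty_of_gm_boxCrossingBounds_uniform_univ`, then
`real_transfer_embAltArmEvent`.) [folklore] -/
theorem exists_type_copy_embAltArmEvent [G.LocallyFinite] (hiso : emb.IsIsoradial)
    (hrh : emb.IsRhombicTiling) :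
    ∃ (V₀ F₀ : Type) (_ : Countable V₀) (_ : DecidableEq V₀) (_ : DecidableEq F₀)
      (G₀ : SimpleGraph V₀) (_ : G₀.LocallyFinite) (emb₀ : RhombicEmbedding G₀ F₀) (e : V₀ ≃ V),
      (G.Preconnected → G₀.Preconnected) ∧ emb₀.IsIsoradial ∧ emb₀.IsRhombicTiling ∧
      (∀ ε : ℝ, emb.HasBoundedAngles ε → emb₀.HasBoundedAngles ε) ∧
      (∀ [DecidableEq V] [DecidableEq F] (I : ℕ), emb.SquareGridPropertyGM I →
        emb₀.SquareGridPropertyGM I) ∧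
      (∀ v₀ : V₀, emb₀.z v₀ = emb.z (e v₀)) ∧
      ∀ j r R : ℕ, emb₀.isoradialPercolation.real (emb₀.embAltArmEvent j r R) =
        emb.isoradialPercolation.real (emb.embAltArmEvent j r R) := by
  classical
  obtain ⟨f, hf⟩ := Countable.exists_injective_nat V
  let V₀ : Type := Set.range f
  let eV : V ≃ V₀ := Equiv.ofInjective f hf
  let F₀ : Type := Set.range emb.c
  let eF : F ≃ F₀ := Equiv.ofInjective emb.c hrh.c_injective
  let G₀ : SimpleGraph V₀ := G.comap eV.symm
  let φ : G₀ ≃g G := SimpleGraph.Iso.comap eV.symm G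
  letI : G₀.LocallyFinite := fun v =>
    Fintype.ofEquiv (G.neighborSet (φ v)) (φ.mapNeighborSet v).symm
  let emb₀ : RhombicEmbedding G₀ F₀ := emb.transfer φ eF
  refine ⟨V₀, F₀, inferInstance, inferInstance, inferInstance, G₀, inferInstance, emb₀,
    eV.symm, fun hconn => φ.preconnected_iff.2 hconn, hiso.transfer, hrh.transfer hiso,
    fun ε hbap => hbap.transfer, fun I hsgp => ?_, fun v₀ => rfl,
    fun j r R => real_transfer_embAltArmEvent hiso j r R⟩
  convert hsgp.transfer (φ := φ) (eF := eF) hiso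

end Shrink

end Literature.Probability.Percolation

end
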